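import Literature.NumberTheory.Automorphic.IsAutomorphicAE
import Literature.NumberTheory.Automorphic.AdicCompletionLocalField
import Literature.NumberTheory.GaloisRepresentations.ResidualGaloisRep
import HarnessLib

/-!
# Weight-one modularity lifting over `ℚ` for `ρ` UNRAMIFIED at `p`, without `p`-distinguishedness:
# Calegari, J. reine angew. Math. 740 (2018), Thm. 1.1 (non-minimal; Calegari–Geraghty 2018 Cor. 1.4 minimal)

Topic `Literature/NumberTheory/Automorphic`; companion of `FontaineMazurGL2WeightOne` (Pan 2022 Thm. 1.0.5:
weight `(0,0)` WITH the Taylor–Wiles and local-GENERICITY hypotheses), which records in its "What is NOT here"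
that the non-generic local residual shapes `η ⊕ η`, `η ⊕ ηω^{±1}` are "in print only for `ρ` UNRAMIFIED at `p`:
Buzzard–Taylor 1999 (`p`-distinguished), Calegari–Geraghty 2018 Cor. 1.4 (minimal) — not vendored here".
This file vendors, as a NAMED FACT (D-0014, conventions §4), the printed NON-MINIMAL theorem of that family:
Calegari's weight-one lifting theorem for odd `ρ : G_ℚ → GL₂(ℚ̄_p)` unramified at `p`, with NO hypothesis on
`ρ̄(Frob_p)` (equal eigenvalues allowed — the case inaccessible to Buzzard–Taylor gluing and to every printed
theorem over totally real fields `F ≠ ℚ`), proved by patching the coherent cohomology of modular curves in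
weight one in two degrees (positive defect `l₀ = 1`) with ordinary lifting in weight `p` as input.

## The printed theorem (held text arXiv:1502.00029, p. 3, quoted)

F. Calegari, *Non-minimal modularity lifting in weight one*, J. reine angew. Math. 740 (2018) 41–62
[Calegari2018NonMinimalWeightOne].  "Let us fix a prime `p > 2` and a local field `[E:ℚ_p] < ∞` with ring of
integers `𝒪` and residue field `k = 𝒪/ϖ`.  **Theorem 1.1.** Let `p > 2`, and let `ρ : G_ℚ → GL₂(𝒪)` be a
continuous odd Galois representation ramified at finitely many primes and unramified at `p`.  Suppose that `ρ̄`
is absolutely irreducible.  If `ρ` is ramified at a prime `ℓ`, assume that `ρ|D_ℓ` is reducible.  Then `ρ` is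
modular of weight one."  (Same page: "The assumption that the representations are unramified at `p`, however,
seems essential for the method (if one does not use base change)".)  The minimal predecessor: Calegari–Geraghty,
Invent. Math. 211 (2018), Cor. 1.4 (held text arXiv:1207.4224 p. 3): `p ≥ 3`, `ρ : G_ℚ → GL₂(𝒪)` continuous
with `ρ(I_v) ≅ ρ̄(I_v)` or `dim ρ^{I_v} = dim ρ̄^{I_v} = 1` at every `v`, `ρ̄` odd and irreducible, `ρ`
unramified at `p` ⇒ `ρ` modular of weight one; "The method of [BuzzT] applies in a non-minimal situation, but
it requires the hypothesis that `ρ̄(Frob_p)` has distinct eigenvalues."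

## The rendering (typed vocabulary of `FontaineMazurGL2WeightOne` and of the summit `Langlands`)

* `ρ : FramedGaloisRep ℚ (PadicAlgCl p) 2` — a CONTINUOUS homomorphism `Γ_ℚ →ₜ* GL₂(ℚ̄_p)` (a continuous
  `ρ : G_ℚ → GL₂(𝒪)`, `𝒪 ⊂ E ⊂ ℚ̄_p`, is one; conversely a continuous `ρ` into `GL₂(ℚ̄_p)` with compact
  source lands in some `GL₂(𝒪_E)` after conjugation — Baire / Skinner's lemma — and modularity is insensitive
  to the conjugation, so quantifying over `FramedGaloisRep` renders the printed class);
  "ramified at finitely many primes" — `∀ᶠ v in cofinite, ρ.IsUnramifiedAt v`; "unramified at `p`" —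
  `ρ.IsUnramifiedAt v` at the place `v ∋ p`; "odd" — `ρ.IsOdd`; "`ρ̄` absolutely irreducible" — the accepted
  `ρ.IsResiduallyAbsIrreducible`; irreducibility of `ρ` itself (a consequence) is carried as an explicit,
  formally STRONGER hypothesis, so the rendered fact is implied by the printed one.
* "if `ρ` is ramified at `ℓ` then `ρ|D_ℓ` is reducible" — at every place `v ∌ p` with `¬ ρ.IsUnramifiedAt v`,
  the local representation `ρ.toLocal v : Γ_{ℚ_v} →ₜ* GL₂(ℚ̄_p)` (restriction along the tree's fixed
  `Γ_{ℚ_v} → Γ_ℚ`; reducibility is conjugation invariant, so the choice of decomposition group is immaterial)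
  is NOT irreducible: `¬ (ρ.toLocal v).toGaloisRep.IsIrreducible`.
* CONCLUSION, automatically (as `Pan2022_fontaineMazurGL2_weightOne`, `Tung2021_hilbertTotallySplit` and the
  summit's clause (B) `Summit.Langlands.GaloisToAutomorphic`): for every `hcpt` and every `ι : ℚ̄_p ≃+* ℂ` there
  is a CUSPIDAL automorphic representation `π` of `GL₂(𝔸_ℚ)` which is `L`-ALGEBRAIC and attached to `ρ` at
  almost all places, `SatakeFrobCompatibleAE ι π ρ`.  This is implied by the printed conclusion exactly as
  explained in `FontaineMazurGL2WeightOne` (module docstring, CONCLUSION): "modular of weight one" = `ρ ≅ ρ_f`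
  for a classical weight-one cuspidal eigenform `f` (Deligne–Serre), whose unitary `π_{f^σ}`, `σ = ι ∘ λ`, is
  `L`-algebraic without twist (Buzzard–Gee §3.1, `k = 1` odd) with Satake parameters at `q ∤ Np` the roots of
  `X² - a_q X + χ(q)`, matching `charpoly ρ(Frob_q)` through `ι`.  The finer printed information (integral
  `R = 𝕋`, Thm. 1.2; finite image; the level) is deliberately NOT rendered.

## What is NOT here

No discharge (XL: Katz weight-one forms over `𝒪/ϖⁿ`, the Calegari–Geraghty patching of `H⁰`/`H¹` of `ω`,
local–global compatibility for torsion weight-one Galois representations, ordinary `R = 𝕋` in weight `p`);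
`p = 2`; `F ≠ ℚ` (OPEN even for `F` totally real with `p` split: Deo–Dimitrov–Wiese, arXiv:1911.11196 pp. 3–4,
"a first step towards an `R = 𝕋` theorem" in parallel weight one over `F` of degree `d ≥ 2`); `ρ` ramified at
`p`; ramified places with `ρ|D_ℓ` irreducible (Calegari: "we do not strive for maximal generality").

## References

* F. Calegari, *Non-minimal modularity lifting in weight one*, J. reine angew. Math. 740 (2018) 41–62
  (arXiv:1502.00029), Thm. 1.1, Thm. 1.2, §1.1. [Calegari2018NonMinimalWeightOne]
* F. Calegari, D. Geraghty, *Modularity lifting beyond the Taylor–Wiles method*, Invent. Math. 211 (2018)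
  297–433 (arXiv:1207.4224), Thm. 1.3, Cor. 1.4, Cor. 1.5. [CalegariGeraghty2017]
* K. Buzzard, R. Taylor, Ann. of Math. 149 (1999) 905–919. [BuzzardTaylor1999]
* S. V. Deo, M. Dimitrov, G. Wiese, *Unramifiedness of weight one Hilbert Hecke algebras* (arXiv:1911.11196),
  Thm. 1, Cor. (cor:RT).
* P. Deligne, J.-P. Serre, Ann. Sci. ÉNS 7 (1974), Thm. 6.1. [DeligneSerreASENS1974]
* K. Buzzard, T. Gee, LMS Lecture Note Ser. 414 (2014), §3.1. [BuzzardGeeLMS2014]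
-/

noncomputable section

open scoped MatrixGroups Matrix NumberField
open NumberField IsDedekindDomain Field Filter

namespace Literature.NumberTheory.Automorphic

open Literature.NumberTheory.GaloisRepresentations

/-- **Calegari 2018 (J. reine angew. Math. 740), Thm. 1.1: non-minimal modularity lifting in WEIGHT ONE over
`ℚ` for `ρ` unramified at `p`, no `p`-distinguishedness** (module docstring for the printed statement and the
rendering).  Let `p > 2` and let `ρ : Γ_ℚ → GL₂(ℚ̄_p)` be continuous, unramified at all but finitely many places
and UNRAMIFIED at the place above `p`, irreducible and odd, with `ρ̄` absolutely irreducible, such that at every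
ramified place `v ∌ p` the local representation `ρ|Γ_{ℚ_v}` is reducible.  Then `ρ` is modular of weight one;
rendered: for every `hcpt` and every `ι : ℚ̄_p ≃+* ℂ` there is a cuspidal automorphic representation `π` of
`GL₂(𝔸_ℚ)`, `L`-algebraic, with `SatakeFrobCompatibleAE ι π ρ`.  Named fact (D-0014); users take
`(h : Calegari2018_weightOneLifting_unramifiedAtP)`.
[cite: Calegari2018NonMinimalWeightOne, Thm. 1.1 (p. 3 of arXiv:1502.00029) and §1.1]
[cite: CalegariGeraghty2017, Cor. 1.4] [cite: DeligneSerreASENS1974, Thm. 6.1] [cite: BuzzardGeeLMS2014, §3.1] -/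
def Calegari2018_weightOneLifting_unramifiedAtP : Prop :=
  ∀ (p : ℕ) [Fact p.Prime], p ≠ 2 →
    ∀ (ρ : FramedGaloisRep ℚ (PadicAlgCl p) 2),
      (∀ᶠ v : HeightOneSpectrum (𝓞 ℚ) in cofinite, ρ.IsUnramifiedAt v) →
      (∀ v : HeightOneSpectrum (𝓞 ℚ), ((p : ℕ) : 𝓞 ℚ) ∈ v.asIdeal → ρ.IsUnramifiedAt v) →
      ρ.toGaloisRep.IsIrreducible → ρ.IsOdd → ρ.IsResiduallyAbsIrreducible →
      (∀ v : HeightOneSpectrum (𝓞 ℚ), ((p : ℕ) : 𝓞 ℚ) ∉ v.asIdeal → ¬ ρ.IsUnramifiedAt v →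
          ¬ (ρ.toLocal v).toGaloisRep.IsIrreducible) →
      ∀ (hcpt : isCompact_glFiniteIntegralLevel 2 ℚ) (ι : PadicAlgCl p ≃+* ℂ),
        ∃ π : CuspidalAutomorphicRepData 2 ℚ hcpt, π.1.IsLAlgebraic ∧ SatakeFrobCompatibleAE ι π.1 ρ

end Literature.NumberTheory.Automorphic

end
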